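import Summits.AtomisticToContinuum.BoseEinsteinCondensation.Theorems.ParticleTensorisation.Negative.PosdefDressingKernel
import Summits.AtomisticToContinuum.BoseEinsteinCondensation.Theorems.ParticleTensorisation.Negative.PosdefDressingWells

/-!
# Crux `ParticleTensorisation` (stmt-AtomisticToContinuum-14367) — `Negative/`:
# the pair energy on the wells is the Curie–Weiss energy (file E)

Toward `¬ stub_posdefDressing`: for the kernel `U` of file K and a configuration with every
particle in its wells (file W1), the stub's energy `E(X) = ∑_k ∑_{l>k} U(x_k - x_l)` satisfies
`|E(X) + (u/(N-1)) (M(X)² - N)/2| ≤ N² · 4πuNa` (per pair `U(x_k - x_l) = -s_k s_l u/(N-1) ± 4πuNa`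
by the well estimate, and `∑_{k<l} s_k s_l = (M² - N)/2`). Also: `E` is measurable and
`|E| ≤ N² u`. Rung style (defining hypotheses, no definitions).
-/

noncomputable section

namespace Summit.AtomisticToContinuum.BoseEinsteinCondensation.Theorems.PosdefDressingNeg

open MeasureTheory Function Finset Set
open scoped ENNReal
open Literature.MathematicalPhysics.QuantumManyBody.BoseGas

/-- **Triangular sum of unit spins**: `∑_k ∑_{l>k} f_k f_l = ((∑ f)² - N)/2` when `f_k² = 1`.
[folklore] -/
theorem sum_sum_lt_mul_eq {N : ℕ} (f : Fin N → ℝ) (hf : ∀ k, f k ^ 2 = 1) :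
    ∑ k, ∑ l ∈ (univ : Finset (Fin N)) with k < l, f k * f l = ((∑ k, f k) ^ 2 - N) / 2 := by
  classical
  -- the sum over ordered pairs splits into `<`, `>` and the diagonal
  have hlt : ∑ p ∈ (univ : Finset (Fin N × Fin N)) with p.1 < p.2, f p.1 * f p.2 =
      ∑ k, ∑ l ∈ (univ : Finset (Fin N)) with k < l, f k * f l := by
    rw [← Finset.sum_finset_product' _ univ (fun k => univ.filter fun l => k < l) ?_]
    intro p
    simp
  have hgt : ∑ p ∈ (univ : Finset (Fin N × Fin N)) with p.2 < p.1, f p.1 * f p.2 =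
      ∑ p ∈ (univ : Finset (Fin N × Fin N)) with p.1 < p.2, f p.1 * f p.2 := by
    refine Finset.sum_equiv (Equiv.prodComm (Fin N) (Fin N)) (fun p => ?_) (fun p _ => ?_)
    · simp
    · simp [mul_comm]
  have hdiag : ∑ p ∈ (univ : Finset (Fin N × Fin N)) with p.1 = p.2, f p.1 * f p.2 = N := by
    have hset : (univ : Finset (Fin N × Fin N)).filter (fun p => p.1 = p.2) =
        (univ : Finset (Fin N)).map ⟨fun k => (k, k), fun a b h => (Prod.mk.inj h).1⟩ := by
      ext p
      simp only [Finset.mem_filter, Finset.mem_univ, true_and, Finset.mem_map,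
        Function.Embedding.coeFn_mk]
      constructor
      · intro h; exact ⟨p.1, by rw [Prod.ext_iff]; exact ⟨rfl, h⟩⟩
      · rintro ⟨k, hk⟩; rw [← hk]
    rw [hset, Finset.sum_map]
    simp only [Function.Embedding.coeFn_mk]
    have : ∀ k, f k * f k = 1 := fun k => by rw [← sq]; exact hf k
    simp [this]
  have hsq : (∑ k, f k) ^ 2 = ∑ p ∈ (univ : Finset (Fin N × Fin N)), f p.1 * f p.2 := by
    rw [sq, Finset.sum_mul_sum, ← Finset.univ_product_univ, Finset.sum_product]
  have hsplit : ∑ p ∈ (univ : Finset (Fin N × Fin N)), f p.1 * f p.2 =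
      ∑ p ∈ (univ : Finset (Fin N × Fin N)) with p.1 < p.2, f p.1 * f p.2 +
        (∑ p ∈ (univ : Finset (Fin N × Fin N)) with p.2 < p.1, f p.1 * f p.2 +
          ∑ p ∈ (univ : Finset (Fin N × Fin N)) with p.1 = p.2, f p.1 * f p.2) := by
    rw [← Finset.sum_filter_add_sum_filter_not univ (fun p : Fin N × Fin N => p.1 < p.2)]
    congr 1
    rw [← Finset.sum_filter_add_sum_filter_not _ (fun p : Fin N × Fin N => p.2 < p.1),
      Finset.filter_filter, Finset.filter_filter]
    congr 1
    · refine Finset.sum_congr ?_ fun _ _ => rfl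
      ext p
      simp only [Finset.mem_filter, Finset.mem_univ, true_and]
      exact ⟨fun h => h.2, fun h => ⟨not_lt.mpr h.le, h⟩⟩
    · refine Finset.sum_congr ?_ fun _ _ => rfl
      ext p
      simp only [Finset.mem_filter, Finset.mem_univ, true_and, not_lt]
      exact ⟨fun h => le_antisymm h.2 h.1, fun h => ⟨h.ge, h.le⟩⟩
  rw [← hlt]
  rw [hsq, hsplit, hgt, hdiag]
  ring

section Model

variable {N : ℕ} {a u : ℝ} {U : Space → ℝ}
variable {qp qm : Fin N → Fin 3 → ℝ} {Wp Wm : Fin N → Set Space} {s : Space → ℝ}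
  {M E : (Fin N → Space) → ℝ}

/-- **Per-pair estimate on the wells**: `|U(x_k - x_l) + s_k s_l u/(N-1)| ≤ 4πuNa` for `k ≠ l`.
[folklore] -/
theorem abs_U_pair_le (hu : 0 ≤ u) (hN : 2 ≤ N)
    (hU : ∀ y, U y = u / ((N : ℝ) - 1) *
      ∑ m ∈ range (N - 1), Real.cos (2 * Real.pi * (y 0 + (m + 1 : ℝ) * y 1)))
    (hs : ∀ x, s x = if x 0 < 5 / 4 then 1 else -1)
    (hqp : ∀ k, qp k = ![1, 1 + (k : ℝ) / N, 1]) (hqm : ∀ k, qm k = ![3 / 2, 1 + (k : ℝ) / N, 1])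
    (hWp : ∀ k, Wp k = {x : Space | ∀ i, x i ∈ Ioo (qp k i) (qp k i + a)})
    (hWm : ∀ k, Wm k = {x : Space | ∀ i, x i ∈ Ioo (qm k i) (qm k i + a)}) (ha0 : 0 ≤ a)
    (ha : a ≤ 1 / 4) {k l : Fin N} (hkl : k ≠ l) {X : Fin N → Space}
    (hk : X k ∈ Wp k ∪ Wm k) (hl : X l ∈ Wp l ∪ Wm l) :
    |U (X k - X l) + s (X k) * s (X l) * (u / ((N : ℝ) - 1))| ≤ 4 * Real.pi * u * N * a := by
  -- the height difference
  have hd0 : ((k : ℤ) - l : ℤ) ≠ 0 := by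
    have : (k : ℕ) ≠ l := fun h => hkl (Fin.ext h)
    omega
  have hdN : |((k : ℤ) - l : ℤ)| < N := by
    have h1 := k.isLt; have h2 := l.isLt
    rw [abs_lt]; constructor <;> omega
  have hy1 : |(X k - X l) 1 - (((k : ℤ) - l : ℤ) : ℝ) / N| ≤ a := by
    rw [PiLp.sub_apply]
    have hk1 : X k 1 ∈ Ioo (1 + ((k : ℕ) : ℝ) / N) (1 + ((k : ℕ) : ℝ) / N + a) := by
      rcases hk with h | h
      · rw [hWp] at h; have := h 1; simpa [hqp] using this
      · rw [hWm] at h; have := h 1; simpa [hqm] using this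
    have hl1 : X l 1 ∈ Ioo (1 + ((l : ℕ) : ℝ) / N) (1 + ((l : ℕ) : ℝ) / N + a) := by
      rcases hl with h | h
      · rw [hWp] at h; have := h 1; simpa [hqp] using this
      · rw [hWm] at h; have := h 1; simpa [hqm] using this
    push_cast
    rw [abs_le, sub_div]
    constructor <;> linarith [hk1.1, hk1.2, hl1.1, hl1.2]
  -- coordinate `0` of the four kinds of pairs
  have hp0 : ∀ {j : Fin N} {x : Space}, x ∈ Wp j → x 0 ∈ Ioo (1 : ℝ) (1 + a) := fun {j x} h => by
    rw [hWp] at h; have := h 0; simpa [hqp] using this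
  have hm0 : ∀ {j : Fin N} {x : Space}, x ∈ Wm j → x 0 ∈ Ioo (3 / 2 : ℝ) (3 / 2 + a) := fun {j x} h => by
    rw [hWm] at h; have := h 0; simpa [hqm] using this
  rcases hk with hk' | hk' <;> rcases hl with hl' | hl'
  · -- (+,+)
    rw [s_of_mem_Wp hs hqp hWp ha hk', s_of_mem_Wp hs hqp hWp ha hl', one_mul]
    refine abs_U_add_le hu hN hU (Or.inl ⟨rfl, rfl⟩) hd0 hdN ha0 _ ?_ hy1
    rw [PiLp.sub_apply, abs_le]
    constructor <;> linarith [(hp0 hk').1, (hp0 hk').2, (hp0 hl').1, (hp0 hl').2]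
  · -- (+,-)
    rw [s_of_mem_Wp hs hqp hWp ha hk', s_of_mem_Wm hs hqm hWm hl', one_mul]
    have h := abs_U_add_le hu hN hU (c₀ := -1 / 2) (ε := -1) (Or.inr (Or.inr ⟨rfl, rfl⟩)) hd0 hdN
      ha0 (X k - X l) ?_ hy1
    · simpa using h
    rw [PiLp.sub_apply, abs_le]
    constructor <;> linarith [(hp0 hk').1, (hp0 hk').2, (hm0 hl').1, (hm0 hl').2]
  · -- (-,+)
    rw [s_of_mem_Wm hs hqm hWm hk', s_of_mem_Wp hs hqp hWp ha hl', mul_one]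
    have h := abs_U_add_le hu hN hU (c₀ := 1 / 2) (ε := -1) (Or.inr (Or.inl ⟨rfl, rfl⟩)) hd0 hdN
      ha0 (X k - X l) ?_ hy1
    · simpa using h
    rw [PiLp.sub_apply, abs_le]
    constructor <;> linarith [(hm0 hk').1, (hm0 hk').2, (hp0 hl').1, (hp0 hl').2]
  · -- (-,-)
    rw [s_of_mem_Wm hs hqm hWm hk', s_of_mem_Wm hs hqm hWm hl', neg_one_mul, neg_neg]
    refine abs_U_add_le hu hN hU (Or.inl ⟨rfl, rfl⟩) hd0 hdN ha0 _ ?_ hy1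
    rw [PiLp.sub_apply, abs_le]
    constructor <;> linarith [(hm0 hk').1, (hm0 hk').2, (hm0 hl').1, (hm0 hl').2]

/-- **The pair energy on the wells is the Curie–Weiss energy**:
`|E(X) + (u/(N-1)) (M² - N)/2| ≤ N² · 4πuNa`. [folklore] -/
theorem abs_E_add_le (hu : 0 ≤ u) (hN : 2 ≤ N)
    (hU : ∀ y, U y = u / ((N : ℝ) - 1) *
      ∑ m ∈ range (N - 1), Real.cos (2 * Real.pi * (y 0 + (m + 1 : ℝ) * y 1)))
    (hs : ∀ x, s x = if x 0 < 5 / 4 then 1 else -1)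
    (hqp : ∀ k, qp k = ![1, 1 + (k : ℝ) / N, 1]) (hqm : ∀ k, qm k = ![3 / 2, 1 + (k : ℝ) / N, 1])
    (hWp : ∀ k, Wp k = {x : Space | ∀ i, x i ∈ Ioo (qp k i) (qp k i + a)})
    (hWm : ∀ k, Wm k = {x : Space | ∀ i, x i ∈ Ioo (qm k i) (qm k i + a)}) (ha0 : 0 ≤ a)
    (ha : a ≤ 1 / 4) (hM : ∀ X, M X = ∑ k, s (X k))
    (hE : ∀ X, E X = ∑ k : Fin N, ∑ l : Fin N with k < l, U (X k - X l))
    {X : Fin N → Space} (hX : ∀ k, X k ∈ Wp k ∪ Wm k) :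
    |E X + u / ((N : ℝ) - 1) * ((M X) ^ 2 - N) / 2| ≤ (N : ℝ) ^ 2 * (4 * Real.pi * u * N * a) := by
  have hP : ∑ k, ∑ l ∈ (univ : Finset (Fin N)) with k < l, s (X k) * s (X l) =
      ((M X) ^ 2 - N) / 2 := by
    rw [hM]; exact sum_sum_lt_mul_eq (fun k => s (X k)) fun k => s_sq hs (X k)
  have hrw : E X + u / ((N : ℝ) - 1) * ((M X) ^ 2 - N) / 2 =
      ∑ k, ∑ l ∈ (univ : Finset (Fin N)) with k < l,
        (U (X k - X l) + s (X k) * s (X l) * (u / ((N : ℝ) - 1))) := by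
    rw [hE]
    simp_rw [Finset.sum_add_distrib]
    rw [mul_div_assoc, ← hP, Finset.mul_sum]
    congr 1
    refine Finset.sum_congr rfl fun k _ => ?_
    rw [Finset.mul_sum]
    refine Finset.sum_congr rfl fun l _ => ?_
    ring
  rw [hrw]
  calc |∑ k, ∑ l ∈ (univ : Finset (Fin N)) with k < l,
        (U (X k - X l) + s (X k) * s (X l) * (u / ((N : ℝ) - 1)))|
      ≤ ∑ k, |∑ l ∈ (univ : Finset (Fin N)) with k < l,
        (U (X k - X l) + s (X k) * s (X l) * (u / ((N : ℝ) - 1)))| := abs_sum_le_sum_abs _ _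
    _ ≤ ∑ k, ∑ l ∈ (univ : Finset (Fin N)) with k < l,
        |U (X k - X l) + s (X k) * s (X l) * (u / ((N : ℝ) - 1))| :=
        Finset.sum_le_sum fun k _ => abs_sum_le_sum_abs _ _
    _ ≤ ∑ k, ∑ l ∈ (univ : Finset (Fin N)) with k < l, 4 * Real.pi * u * N * a :=
        Finset.sum_le_sum fun k _ => Finset.sum_le_sum fun l hl => by
          have hkl : k ≠ l := ne_of_lt (Finset.mem_filter.mp hl).2
          exact abs_U_pair_le hu hN hU hs hqp hqm hWp hWm ha0 ha hkl (hX k) (hX l)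
    _ ≤ ∑ _k : Fin N, ∑ _l : Fin N, 4 * Real.pi * u * N * a :=
        Finset.sum_le_sum fun k _ => Finset.sum_le_sum_of_subset_of_nonneg (Finset.filter_subset _ _)
          fun _ _ _ => by positivity
    _ = (N : ℝ) ^ 2 * (4 * Real.pi * u * N * a) := by
        rw [Finset.sum_const, Finset.sum_const, Finset.card_univ, Fintype.card_fin, nsmul_eq_mul,
          nsmul_eq_mul]
        ring

/-- `E` is measurable (for continuous `U`). [folklore] -/
theorem measurable_E (hUc : Continuous U)
    (hE : ∀ X, E X = ∑ k : Fin N, ∑ l : Fin N with k < l, U (X k - X l)) : Measurable E := by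
  have h : E = fun X => ∑ k : Fin N, ∑ l : Fin N with k < l, U (X k - X l) := funext hE
  rw [h]
  refine Finset.measurable_sum _ fun k _ => Finset.measurable_sum _ fun l _ => ?_
  exact hUc.measurable.comp ((measurable_pi_apply k).sub (measurable_pi_apply l))

/-- `|E| ≤ N² u` (crudely, from `|U| ≤ u`). [folklore] -/
theorem abs_E_le (hu : 0 ≤ u)
    (hU : ∀ y, U y = u / ((N : ℝ) - 1) *
      ∑ m ∈ range (N - 1), Real.cos (2 * Real.pi * (y 0 + (m + 1 : ℝ) * y 1)))
    (hE : ∀ X, E X = ∑ k : Fin N, ∑ l : Fin N with k < l, U (X k - X l)) (X : Fin N → Space) :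
    |E X| ≤ (N : ℝ) ^ 2 * u := by
  rw [hE]
  calc |∑ k : Fin N, ∑ l : Fin N with k < l, U (X k - X l)|
      ≤ ∑ k : Fin N, |∑ l : Fin N with k < l, U (X k - X l)| := abs_sum_le_sum_abs _ _
    _ ≤ ∑ k : Fin N, ∑ l : Fin N with k < l, |U (X k - X l)| :=
        Finset.sum_le_sum fun k _ => abs_sum_le_sum_abs _ _
    _ ≤ ∑ k : Fin N, ∑ l : Fin N with k < l, u :=
        Finset.sum_le_sum fun k _ => Finset.sum_le_sum fun l _ => abs_U_le hu hU _
    _ ≤ ∑ _k : Fin N, ∑ _l : Fin N, u :=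
        Finset.sum_le_sum fun k _ => Finset.sum_le_sum_of_subset_of_nonneg (Finset.filter_subset _ _)
          fun _ _ _ => hu
    _ = (N : ℝ) ^ 2 * u := by
        rw [Finset.sum_const, Finset.sum_const, Finset.card_univ, Fintype.card_fin, nsmul_eq_mul,
          nsmul_eq_mul]
        ring

end Model

end Summit.AtomisticToContinuum.BoseEinsteinCondensation.Theorems.PosdefDressingNeg

end
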